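import Summits.AtomisticToContinuum.Crystallization.Theses.BrittleRungDescent
import Summits.AtomisticToContinuum.Crystallization.Theorems.MinMeanCycleStackingLockBasedDefectVanishCrystallizes
import Summits.AtomisticToContinuum.Crystallization.Theorems.BrittleRungDescentMieRungReduction

/-!
# Birth skeleton (BC3) for crux `BrittleRungDescent.BrittleBarlowRigidity`
# (item stmt-AtomisticToContinuum-10942, rank 2 of route-AtomisticToContinuum-BrittleRungDescent)
# — published as `Cruxes/BrittleBarlowRigidity/Lines/birth.lean`

The crux (BARLOW-TRUSS RIGIDITY, brittle regime): there are `η₁ ∈ (0, 1/100]` and `p₁` such that for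
every `p ≥ p₁`, if the Mie `(2p, p)` potential `V_p = miePotential p` has ground states for all `N` and
along every ground-state sequence all but `o(N)` atoms have a `4`-ball in which EVERY atom is softly
twelve-kissed (tolerance `η₁`, gap `63/50`) with an fcc- or hcp-pattern soft contact graph, then
`HasPeriodicGroundStateEnergy V_p 3 ∧ IsCrystallizing V_p 3`.

## The line — the route header's own two-layer plan, typed
("BrittleBarlowRigidity ⇐ BarlowTrussKorn → ActionReactionSurface → HaggFaultSelection"), cut so
that the energetic tail is DISCHARGED by theorems already landed for this route:

* `stub_barlowWindows` (S1 — BARLOW-TRUSS KORN / VANISHING STRAIN, size XL): for some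
  `η₁ ∈ (0, 1/100]` and all large `p`, along every ground-state sequence of `V_p` whose atoms are
  Barlow-locally-ordered off `o(N)` (the crux hypothesis, per sequence), for every window radius `R`
  and tolerance `ε` all but `o(N)` atoms `i` have the particles of `B_R(x_i)` two-way `ε`-matched, after
  a linear isometry, to a window of SOME Barlow stacking `barlowStacking a h s` (`a, h ∈ (1/2, 2)`, `s`
  any Hägg sequence) — the shape of item stmt-AtomisticToContinuum-14292 (`LaminarBarlowWindows`, stated
  there for Lennard-Jones) over `miePotential p`. Engine: off the defect set the bond network is a
  bounded-strain realisation of a tetrahedron–octahedron (Barlow) truss (combinatorial layer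
  propagation, cf. the PROVED `SoftLayerPropagation`, item 9210); cell-wise rigidity + a discrete Korn /
  Friesecke–James–Müller inequality uniform in the Hägg word bound the strain energy by the excess energy
  `E(N) − N·inf_w e_B(w) ≤ θN + C_θ N^{2/3}` (trial clusters of near-optimal PERIODIC Barlow stackings —
  no Hägg domination needed here) plus `C·#defects = o(N)`; Markov in `i` and truss rigidity on `B_R`
  give the windows. Fixed tolerance alone does NOT give large windows (strain `η₁·R` accumulates): the
  energy is essential, which is why this is a stub and not bookkeeping.
* `stub_stackingSelection` (S2 — HÄGG FAULT SELECTION inside finite ground states, size XL, the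
  stub that carries the crux's declared risk): for all large `p` there is ONE periodic configuration `P`
  of `ℝ³` (intended: relaxed hcp, `hcpPeriodicConfiguration a* h*` re-based) such that along every
  ground-state sequence of `V_p`, Barlow windows at all scales (the conclusion of S1) upgrade to BASED
  `P`-windows at all scales: all but `o(N)` atoms `i` admit a linear isometry `A` and a base point
  `q₀ ∈ P.points` with `B_R(x_i)` two-way `ε`-matched to `x_i + A((P.points − q₀) ∩ B̄_R(q₀))` — exactly
  the hypothesis `hBDV` of the landed soft assembly lemma `isCrystallizing_of_bulkDefectVanishBased`
  at `V = V_p`. Engine: next-nearest-layer coupling `J₂(p) ~ −c·(8/3)^{−p/2}/p ≠ 0` locks the optimal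
  Hägg word (hcp) with a gap per fault and unit layer area; `E(N) ≤ N e(P) + C N^{2/3}` (trial states)
  against `Σ_i (e_loc,i − e(P)) ≥ gap·#(atoms in faulted triples) − o(N)` forces `o(N)` faulted windows;
  strict minimality of the relaxed parameters `(a*, h*)` pins `(a, h)`.
* Composition `BrittleBarlowRigidity_of : Goal.stub_barlowWindows → Goal.stub_stackingSelection → crux`
  (REAL proof, no `sorry`): with `η₁` from S1 and `p ≥ max (max p₁ p₂) (max q₀ 6)`, S1 then S2 give the
  based bulk-defect-vanishing property for `V_p`; the PROVED support item `LadderGroundStates`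
  (`Theorems.LadderGroundStates_proof`, item 10945: `(1 − 2/q)`-separation for `q ≥ q₀ = 500`) and
  `isCrystallizing_of_bulkDefectVanishBased` (item 12025's general-`V` lemma) give
  `IsCrystallizing V_p 3`; `MieRungEnergetic.hasPeriodicGroundStateEnergy_miePotential_of_isCrystallizing`
  (landed in `BrittleRungDescentMieRungReduction.lean`: on the ladder conjunct (ii) implies conjunct (i),
  given existence — the crux's own hypothesis — and separation) gives `HasPeriodicGroundStateEnergy V_p 3`.
* `brittleBarlowRigidity_skeleton : BrittleBarlowRigidity` — the crux BY NAME from the two registered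
  stubs (the only `sorry`s in its cone are `stub_barlowWindows`, `stub_stackingSelection`).

Layout as in the registered skeletons `Cruxes/NearMaxGroundStatesCrystallize/Lines/birth.lean` and
`Cruxes/BulkDefectVanishBased/Lines/birth.lean`: §0 the stub STATEMENTS as `Goal.stub_*` (character for
character the §1 signatures; the composition takes them by name), §1 the registered stubs
`theorem stub_* : <inlined signature> := by sorry`, §2 the composition and the by-name skeleton theorem.

Disproof used: none on file (`ledger crux ls stmt-AtomisticToContinuum-10942`: no workfiles, no
`Disproof.lean`, no `Negative/` lemmas, 2026-08-17). Negatives index (20 refuted statements of the summit;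
4 on Crystallization: GappedShellCensus.ShellCensus 15929, SpectralChargeLedger.OneMultiplierPricing 17253,
BrittleMieDescent.EffectiveLocalHales 4146, OneGrainWindow.OneGrainGluing 3506): neither stub is an
instance — both are asymptotic `o(N)` statements along Mie ground-state sequences; S1 ASSUMES the fcc/hcp
shell graphs (it makes no twelve-shell classification claim, so 4146/15929 do not bear), S2 is a
one-`P` selection statement `∃ P ∀ x`, not the refuted `∀ P` one-grain gluing 3506. Dead lines: none
recorded for this crux.
-/

namespace Summit.AtomisticToContinuum.Crystallization.Cruxes.BrittleBarlowRigidity.Birth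

/-! ## §0 The two stub STATEMENTS as named propositions (namespace `Goal`; each is, character for
character, the signature of the registered stub of the same short name in §1) -/

namespace Goal

/-- Statement of S1 `stub_barlowWindows` (see §1). -/
def stub_barlowWindows : Prop :=
  ∃ η₁ : ℝ, 0 < η₁ ∧ η₁ ≤ 1 / 100 ∧ ∃ p₁ : ℕ, ∀ p : ℕ, p₁ ≤ p → ∀ x : (N : ℕ) → (Fin N → EuclideanSpace ℝ (Fin 3)), (∀ N, Literature.MathematicalPhysics.StatisticalMechanics.IsGroundState (Literature.MathematicalPhysics.StatisticalMechanics.miePotential p) (x N)) → Filter.Tendsto (fun N : ℕ => (Nat.card {i : Fin N // ¬ ∀ j : Fin N, dist (x N i) (x N j) ≤ 4 → (((∀ l : Fin N, l ≠ j → (1 - η₁) ≤ dist (x N j) (x N l) ∧ (dist (x N j) (x N l) ≤ (1 + η₁) ∨ 63 / 50 ≤ dist (x N j) (x N l))) ∧ Nat.card {l : Fin N // l ≠ j ∧ dist (x N j) (x N l) ≤ (1 + η₁)} = 12) ∧ ((∃ e : {k : Fin N // k ≠ j ∧ dist (x N j) (x N k) ≤ (1 + η₁)} ≃ {q : EuclideanSpace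 ℝ (Fin 3) // q ∈ Literature.Geometry.DiscreteGeometry.fccKissingPattern}, ∀ k k' : {k : Fin N // k ≠ j ∧ dist (x N j) (x N k) ≤ (1 + η₁)}, k ≠ k' → (dist (x N k.1) (x N k'.1) ≤ (1 + η₁) ↔ dist (e k).1 (e k').1 = 1)) ∨ (∃ e : {k : Fin N // k ≠ j ∧ dist (x N j) (x N k) ≤ (1 + η₁)} ≃ {q : EuclideanSpace ℝ (Fin 3) // q ∈ Literature.Geometry.DiscreteGeometry.hcpKissingPattern}, ∀ k k' : {k : Fin N // k ≠ j ∧ dist (x N j) (x N k) ≤ (1 + η₁)}, k ≠ k' → (dist (x N k.1) (x N k'.1) ≤ (1 + η₁) ↔ dist (e k).1 (e k').1 = 1))))} : ℝ) / N) Filter.atTop (nhds 0) → ∀ R ε : ℝ, 0 < R → 0 < ε → ε < 1 / 4 → Filter.Tendsto (fun N : ℕ => (Nat.card {i : Fin N // ¬ (∃ a h : ℝ, 1 / 2 < a ∧ a < 2 ∧ 1 / 2 < h ∧ h < 2 ∧ ∃ s : ℤ → ℤ, Literature.MathematicalPhysics.StatisticalMechanics.IsHaggSeq s ∧ ∃ z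 ∈ Literature.MathematicalPhysics.StatisticalMechanics.barlowStacking a h s, ∃ A : EuclideanSpace ℝ (Fin 3) →ₗᵢ[ℝ] EuclideanSpace ℝ (Fin 3), (∀ q ∈ Literature.MathematicalPhysics.StatisticalMechanics.barlowStacking a h s, dist q z ≤ R → ∃ j : Fin N, dist (x N j) (x N i + A (q - z)) ≤ ε) ∧ (∀ j : Fin N, dist (x N j) (x N i) ≤ R → ∃ q ∈ Literature.MathematicalPhysics.StatisticalMechanics.barlowStacking a h s, dist (x N j) (x N i + A (q - z)) ≤ ε))} : ℝ) / N) Filter.atTop (nhds 0)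

/-- Statement of S2 `stub_stackingSelection` (see §1). -/
def stub_stackingSelection : Prop :=
  ∃ p₂ : ℕ, ∀ p : ℕ, p₂ ≤ p → ∃ P : Literature.MathematicalPhysics.StatisticalMechanics.PeriodicConfiguration 3, ∀ x : (N : ℕ) → (Fin N → EuclideanSpace ℝ (Fin 3)), (∀ N, Literature.MathematicalPhysics.StatisticalMechanics.IsGroundState (Literature.MathematicalPhysics.StatisticalMechanics.miePotential p) (x N)) → (∀ R ε : ℝ, 0 < R → 0 < ε → ε < 1 / 4 → Filter.Tendsto (fun N : ℕ => (Nat.card {i : Fin N // ¬ (∃ a h : ℝ, 1 / 2 < a ∧ a < 2 ∧ 1 / 2 < h ∧ h < 2 ∧ ∃ s : ℤ → ℤ, Literature.MathematicalPhysics.StatisticalMechanics.IsHaggSeq s ∧ ∃ z ∈ Literature.MathematicalPhysics.StatisticalMechanics.barlowStacking a h s, ∃ A : EuclideanSpace ℝ (Fin 3) →ₗᵢ[ℝ] EuclideanSpace ℝ (Fin 3), (∀ q ∈ Literature.MathematicalPhysics.StatisticalMechanics.barlowStacking a h s, dist q z ≤ R → ∃ j : Fin N, dist (x N j) (x N i +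 A (q - z)) ≤ ε) ∧ (∀ j : Fin N, dist (x N j) (x N i) ≤ R → ∃ q ∈ Literature.MathematicalPhysics.StatisticalMechanics.barlowStacking a h s, dist (x N j) (x N i + A (q - z)) ≤ ε))} : ℝ) / N) Filter.atTop (nhds 0)) → ∀ R ε : ℝ, 0 < R → 0 < ε → Filter.Tendsto (fun N : ℕ => (Nat.card {i : Fin N // ¬ ∃ A : EuclideanSpace ℝ (Fin 3) →ₗᵢ[ℝ] EuclideanSpace ℝ (Fin 3), ∃ q₀ ∈ P.points, (∀ q ∈ P.points, dist q q₀ ≤ R → ∃ j : Fin N, dist (x N j) (x N i + A (q - q₀)) ≤ ε) ∧ (∀ j : Fin N, dist (x N j) (x N i) ≤ R → ∃ q ∈ P.points, dist (x N j) (x N i + A (q - q₀)) ≤ ε)} : ℝ) / N) Filter.atTop (nhds 0)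

end Goal

/-! ## §1 Registered stubs (the ONLY `sorry`s of the file; signatures fully inlined and qualified) -/

/-- **S1 — Barlow-truss Korn / vanishing strain: Barlow local order off `o(N)` ⇒ Barlow windows at
every scale (size XL).** There are `η₁ ∈ (0, 1/100]` and `p₁` such that for every `p ≥ p₁` and every
sequence `x` of ground states of `V_p = miePotential p`: IF the fraction of atoms `i` that do NOT have a
`4`-ball (`dist ≤ 4`) all of whose atoms `j` are softly twelve-kissed at tolerance `η₁` (all others at
distance `≥ 1 − η₁`, each other atom within `1 + η₁` or beyond `63/50`, exactly twelve within `1 + η₁`)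
with an fcc- or hcp-pattern soft contact graph on the twelve (the crux hypothesis, verbatim, for this
sequence) tends to `0`, THEN for every `R > 0` and `ε ∈ (0, 1/4)` the fraction of atoms `i` whose
`R`-window is NOT two-way `ε`-matched — after `q ↦ x_i + A(q − z)`, `A` a linear isometry, `z` a stacking
point — to `barlowStacking a h s` for some `a, h ∈ (1/2, 2)` and Hägg sequence `s` tends to `0` (the
window predicate of item stmt-AtomisticToContinuum-14292 over `miePotential p`).
Why plausibly true: the contact graph of a region in which every atom has an fcc/hcp shell graph is a
tetrahedron–octahedron truss with a layer structure (Hales's layer propagation, the tree's PROVED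
`HalesDSP_layerPackings_holds` / item 9210); for `p` large the Mie well is a stiff spring (`V_p''(1) = p`,
`iter_deriv_two_miePotential_one`), so cell-wise rigidity and a discrete Korn inequality bound the
total strain energy by the excess energy, which is `≤ θN + C_θ N^{2/3}` for every `θ > 0` by trial
clusters of near-optimal periodic Barlow stackings, plus `O(#defects) = o(N)`; Markov over atoms and
Friesecke–James–Müller rigidity on the truss patch `B_R(x_i)` turn small strain energy into an
`ε`-matched window. Why it might fail: the discrete Korn constant must be uniform in the Hägg word and
the linear term of the expansion around a relaxed reference is only a boundary functional
(action–reaction) — both unproved; long-range dislocation strain fields must stay `o(N)` in energy.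
Sources: FrieseckeJamesMuller2002, Theil2006, FlatleyTheil2015 (arXiv:1407.0692), HalesDSP2012,
Hales2012 (arXiv:1209.6043), arXiv:2204.12892. Leans on: `SoftLayerPropagation` (9210, proved),
`LadderGroundStates_proof` (separation), `BarlowStacking.lean`, `KissingRigidity.lean`. -/
theorem stub_barlowWindows :
    ∃ η₁ : ℝ, 0 < η₁ ∧ η₁ ≤ 1 / 100 ∧ ∃ p₁ : ℕ, ∀ p : ℕ, p₁ ≤ p → ∀ x : (N : ℕ) → (Fin N → EuclideanSpace ℝ (Fin 3)), (∀ N, Literature.MathematicalPhysics.StatisticalMechanics.IsGroundState (Literature.MathematicalPhysics.StatisticalMechanics.miePotential p) (x N)) → Filter.Tendsto (fun N : ℕ => (Nat.card {i : Fin N // ¬ ∀ j : Fin N, dist (x N i) (x N j) ≤ 4 → (((∀ l : Fin N, l ≠ j → (1 - η₁) ≤ dist (x N j) (x N l) ∧ (dist (x N j) (x N l) ≤ (1 + η₁) ∨ 63 / 50 ≤ dist (x N j) (x N l))) ∧ Nat.card {l : Fin N // l ≠ j ∧ dist (x N j) (x N l) ≤ (1 + η₁)} = 12) ∧ ((∃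 e : {k : Fin N // k ≠ j ∧ dist (x N j) (x N k) ≤ (1 + η₁)} ≃ {q : EuclideanSpace ℝ (Fin 3) // q ∈ Literature.Geometry.DiscreteGeometry.fccKissingPattern}, ∀ k k' : {k : Fin N // k ≠ j ∧ dist (x N j) (x N k) ≤ (1 + η₁)}, k ≠ k' → (dist (x N k.1) (x N k'.1) ≤ (1 + η₁) ↔ dist (e k).1 (e k').1 = 1)) ∨ (∃ e : {k : Fin N // k ≠ j ∧ dist (x N j) (x N k) ≤ (1 + η₁)} ≃ {q : EuclideanSpace ℝ (Fin 3) // q ∈ Literature.Geometry.DiscreteGeometry.hcpKissingPattern}, ∀ k k' : {k : Fin N // k ≠ j ∧ dist (x N j) (x N k) ≤ (1 + η₁)}, k ≠ k' → (dist (x N k.1) (x N k'.1) ≤ (1 + η₁) ↔ dist (e k).1 (e k').1 = 1))))} : ℝ) / N) Filter.atTop (nhds 0) → ∀ R ε : ℝ, 0 < R → 0 < ε → ε < 1 / 4 → Filter.Tendsto (fun N : ℕ => (Nat.card {i : Fin N // ¬ (∃ a h : ℝ, 1 / 2 < a ∧ a < 2 ∧ 1 / 2 < h ∧ h < 2 ∧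 ∃ s : ℤ → ℤ, Literature.MathematicalPhysics.StatisticalMechanics.IsHaggSeq s ∧ ∃ z ∈ Literature.MathematicalPhysics.StatisticalMechanics.barlowStacking a h s, ∃ A : EuclideanSpace ℝ (Fin 3) →ₗᵢ[ℝ] EuclideanSpace ℝ (Fin 3), (∀ q ∈ Literature.MathematicalPhysics.StatisticalMechanics.barlowStacking a h s, dist q z ≤ R → ∃ j : Fin N, dist (x N j) (x N i + A (q - z)) ≤ ε) ∧ (∀ j : Fin N, dist (x N j) (x N i) ≤ R → ∃ q ∈ Literature.MathematicalPhysics.StatisticalMechanics.barlowStacking a h s, dist (x N j) (x N i + A (q - z)) ≤ ε))} : ℝ) / N) Filter.atTop (nhds 0) := by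
  sorry

/-- **S2 — Hägg fault selection inside finite ground states: Barlow windows ⇒ based windows of ONE
periodic configuration (size XL; carries the crux's declared risk).** There is `p₂` such that for every
`p ≥ p₂` there is ONE periodic configuration `P` of `ℝ³` such that, along every sequence `x` of ground
states of `V_p = miePotential p` that has Barlow windows at every scale (the conclusion of S1 for this
sequence), for every `R > 0` and `ε > 0` the fraction of atoms `i` admitting NO linear isometry `A` and
base point `q₀ ∈ P.points` with the particles of `B_R(x_i)` two-way `ε`-matched to
`x_i + A((P.points − q₀) ∩ B̄_R(q₀))` tends to `0` — verbatim the hypothesis `hBDV` of the landed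
`isCrystallizing_of_bulkDefectVanishBased` at `V = miePotential p`, `d = 3` (based form: any polytype
is admissible as `P`, no vertex-transitivity is forced).
Why plausibly true: among Barlow stackings of `V_p` the next-nearest-LAYER coupling
`J₂(p) ≈ −c·(8/3)^{−p/2}/p < 0` dominates all further couplings for `p` large (layer sums, cf. the tree's
`BarlowStackingEnergy` / `LayerSumDecay` and items 0716/0737), so the hcp word is locked with a gap
`g_p > 0` per atom of any fcc-type layer triple; the trial bound `E(N) ≤ N·e(P) + C N^{2/3}` (relaxed-hcp
clusters) against `Σ_i (e_loc,i − e(P)) ≥ g_p·#(atoms in faulted triples) − C·#(window-less atoms) −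
tails` forces `#(faulted) = O(N^{2/3}/g_p) + o(N) = o(N)`, and strict minimality of the relaxed
parameters `(a*, h*)` of `e_hcp(a, h)` pins the window parameters; `P := hcpPeriodicConfiguration a* h*`.
Why it might fail: the selection happens at scale `|J₂(p)| ~ 1.63^{−p}/p` per atom while the sticky Wulff
constant prefers fcc facets at order `N^{2/3}` (CKL 2023, (25),(28)) — twinned / mixed fcc–hcp finite
minimisers would break "one `P` for all sequences"; a degenerate or non-unique relaxed parameter pair,
or an aperiodic optimal Hägg word (ANNNI-type frustration from `J₃, J₄, …`), also kills it.
Sources: arXiv:2204.12892, PartayOrtnerCsanyi2017, Stillinger2001, stmt-AtomisticToContinuum-0737,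
BlancLewin2015 §2.3, Literature.Barriers.AtomisticToContinuum.ShortRangeStackingBlindness /
KissingTwelveDegeneracy. Leans on: `barlowPeriodicConfiguration` / `hcpPeriodicConfiguration`
(`BarlowStacking.lean`), `BarlowStackingWindowRebase.twoWayMatch_rebase`, `LadderGroundStates_proof`. -/
theorem stub_stackingSelection :
    ∃ p₂ : ℕ, ∀ p : ℕ, p₂ ≤ p → ∃ P : Literature.MathematicalPhysics.StatisticalMechanics.PeriodicConfiguration 3, ∀ x : (N : ℕ) → (Fin N → EuclideanSpace ℝ (Fin 3)), (∀ N, Literature.MathematicalPhysics.StatisticalMechanics.IsGroundState (Literature.MathematicalPhysics.StatisticalMechanics.miePotential p) (x N)) → (∀ R ε : ℝ, 0 < R → 0 < ε → ε < 1 / 4 → Filter.Tendsto (fun N : ℕ => (Nat.card {i : Fin N // ¬ (∃ a h : ℝ, 1 / 2 < a ∧ a < 2 ∧ 1 / 2 < h ∧ h < 2 ∧ ∃ s : ℤ → ℤ, Literature.MathematicalPhysics.StatisticalMechanics.IsHaggSeq s ∧ ∃ z ∈ Literature.MathematicalPhysics.StatisticalMechanics.barlowStacking a h s, ∃ A : EuclideanSpace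 ℝ (Fin 3) →ₗᵢ[ℝ] EuclideanSpace ℝ (Fin 3), (∀ q ∈ Literature.MathematicalPhysics.StatisticalMechanics.barlowStacking a h s, dist q z ≤ R → ∃ j : Fin N, dist (x N j) (x N i + A (q - z)) ≤ ε) ∧ (∀ j : Fin N, dist (x N j) (x N i) ≤ R → ∃ q ∈ Literature.MathematicalPhysics.StatisticalMechanics.barlowStacking a h s, dist (x N j) (x N i + A (q - z)) ≤ ε))} : ℝ) / N) Filter.atTop (nhds 0)) → ∀ R ε : ℝ, 0 < R → 0 < ε → Filter.Tendsto (fun N : ℕ => (Nat.card {i : Fin N // ¬ ∃ A : EuclideanSpace ℝ (Fin 3) →ₗᵢ[ℝ] EuclideanSpace ℝ (Fin 3), ∃ q₀ ∈ P.points, (∀ q ∈ P.points, dist q q₀ ≤ R → ∃ j : Fin N, dist (x N j) (x N i + A (q - q₀)) ≤ ε) ∧ (∀ j : Fin N, dist (x N j) (x N i) ≤ R → ∃ q ∈ P.points, dist (x N j) (x N i + A (q - q₀)) ≤ ε)} : ℝ) / N) Filter.atTop (nhds 0) := by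
  sorry

/-! ## §2 Composition (kernel-checked, no `sorry`): the stub statements imply the crux BY NAME -/

/-- **Composition: S1 → S2 → `BrittleBarlowRigidity`** (hypotheses = the §0 statements by name,
definitionally the §1 signatures). Take `η₁` from S1 and `p ≥ max (max p₁ p₂) (max q₀ 6)` (`q₀` from the
PROVED support item `LadderGroundStates`); for a ground-state sequence `x` of `V_p` the crux hypothesis
and S1 give Barlow windows at all scales, S2 gives based `P`-windows, i.e. the hypothesis `hBDV` of
`isCrystallizing_of_bulkDefectVanishBased`, which with the `(1 − 2/p)`-separation of ground states
(`LadderGroundStates_proof`) yields `IsCrystallizing V_p 3`; on the ladder conjunct (ii) implies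
conjunct (i) (`hasPeriodicGroundStateEnergy_miePotential_of_isCrystallizing`, using the crux's own
existence hypothesis), whence `HasPeriodicGroundStateEnergy V_p 3`. -/
theorem BrittleBarlowRigidity_of :
    Goal.stub_barlowWindows → Goal.stub_stackingSelection →
    Summit.AtomisticToContinuum.Crystallization.Theses.BrittleRungDescent.BrittleBarlowRigidity := by
  intro hS1 hS2
  unfold Goal.stub_barlowWindows at hS1
  unfold Goal.stub_stackingSelection at hS2
  unfold Summit.AtomisticToContinuum.Crystallization.Theses.BrittleRungDescent.BrittleBarlowRigidity
  obtain ⟨η₁, hη₁, hη₁', p₁, hS1⟩ := hS1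
  obtain ⟨p₂, hS2⟩ := hS2
  have hL := Summit.AtomisticToContinuum.Crystallization.Theorems.LadderGroundStates_proof
  unfold Summit.AtomisticToContinuum.Crystallization.Theses.BrittleRungDescent.LadderGroundStates at hL
  obtain ⟨q₀, hL⟩ := hL
  refine ⟨η₁, hη₁, hη₁', max (max p₁ p₂) (max q₀ 6), fun p hp hA hB => ?_⟩
  have hp₁ : p₁ ≤ p := le_trans (le_trans (le_max_left _ _) (le_max_left _ _)) hp
  have hp₂ : p₂ ≤ p := le_trans (le_trans (le_max_right _ _) (le_max_left _ _)) hp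
  have hq₀ : q₀ ≤ p := le_trans (le_trans (le_max_left _ _) (le_max_right _ _)) hp
  have hp6 : 6 ≤ p := le_trans (le_trans (le_max_right _ _) (le_max_right _ _)) hp
  obtain ⟨-, hsep⟩ := hL p hq₀
  have hδ : (0 : ℝ) < 1 - 2 / (p : ℝ) := by
    have hp6' : (6 : ℝ) ≤ p := by exact_mod_cast hp6
    have h2 : 2 / (p : ℝ) ≤ 1 / 3 := by
      rw [div_le_iff₀ (by linarith)]
      linarith
    linarith
  -- S2: one periodic configuration `P` for this `p`
  obtain ⟨P, hP⟩ := hS2 p hp₂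
  -- S1 then S2 along each ground-state sequence: the based bulk-defect-vanishing property for `V_p`
  have hcrys : Literature.MathematicalPhysics.StatisticalMechanics.IsCrystallizing
      (Literature.MathematicalPhysics.StatisticalMechanics.miePotential p) 3 := by
    refine Summit.AtomisticToContinuum.Crystallization.Theorems.MinMeanCycleStackingLockBasedDefectVanishCrystallizes.isCrystallizing_of_bulkDefectVanishBased
      P ?_ hδ hsep
    intro R ε hR hε x hx
    exact hP x hx (hS1 p hp₁ x hx (hB x hx)) R ε hR hε
  -- on the Mie ladder conjunct (ii) implies conjunct (i) (existence from the crux hypothesis `hA`)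
  exact ⟨Summit.AtomisticToContinuum.Crystallization.Theorems.MieRungEnergetic.hasPeriodicGroundStateEnergy_miePotential_of_isCrystallizing
    hp6 hA hδ hsep hcrys, hcrys⟩

/-- **The registered skeleton in one line**: the two §1 stubs fed into `BrittleBarlowRigidity_of` prove
the crux by name (`#print axioms` reaches `sorryAx` exactly through the two stubs). -/
theorem brittleBarlowRigidity_skeleton :
    Summit.AtomisticToContinuum.Crystallization.Theses.BrittleRungDescent.BrittleBarlowRigidity :=
  BrittleBarlowRigidity_of stub_barlowWindows stub_stackingSelection

/-- The registered stub signatures are, definitionally, the `Goal` statements. -/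
example : Goal.stub_barlowWindows ∧ Goal.stub_stackingSelection :=
  ⟨stub_barlowWindows, stub_stackingSelection⟩

end Summit.AtomisticToContinuum.Crystallization.Cruxes.BrittleBarlowRigidity.Birth
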